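import Summits.QuantumAdvantage.QuantumAdvantage.Theorems.CubicForrelationNearExactIsExactTwelveBoundary
import Summits.QuantumAdvantage.QuantumAdvantage.Theorems.CubicForrelationNearExactIsExactSecondWeight

/-!
# Crux `CubicForrelation.NearExactIsExact` (stmt-QuantumAdvantage-14043) — n = 12 below the second boundary: WILD-POINT PARITY tools

Certificate seat `b2b-cforr-cert` (gen 13).  HONEST FRAMING: generic lemmas (standard axioms) feeding the theorems of
`…TwelveLevelSixPrep.lean` / `…TwelveLevelSixWindow.lean` / `…TwelveLevelFiveWindow.lean` (cubic pairs on 12 bits with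
`Φ ≥ 955/1024` are exact); finite-slice bookkeeping, NOT summit progress.

* `ws_flatPt_mem`: flat points with base in a `V₀`-stable set and directions in the xor-closed `V₀ ∋ 0` stay in the set (any number of
  directions);
* `ws_erm_round`: ONE ROUND OF WILD-POINT PARITY — if an integer function `ψ` has even sum over every parametrised `(r+1)`-flat of the
  coset `c ⊕ V₀` (`#V₀ = 2^m`), then either `ψ` is even on the coset or it is odd at `≥ 2^{m−r}` of its points (Reed–Muller distance on an
  abstract flat, `erm_weight_ge`);
* `ws_card_translate`: translating by `v ∈ V₀` permutes a coset;
* `ws_sum4_mod8`: for a Boolean `h` with base-free second differences `B` along a coset (the output of `fr_hsd`), the sign sum over a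
  parametrised 4-flat `x ⊕ ⟨a₀,a₁,a₂,a₃⟩` is `≡ 4·Pf (mod 8)`, `Pf = B₁₀B₃₂ ⊕ B₂₀B₃₁ ⊕ B₃₀B₂₁` the Pfaffian of the Gram matrix — in
  particular it does not depend on the base point `x`.

References: MacWilliams–Sloane (1977) Ch. 13 §3, Ch. 15 §2; C. Carlet (2021) §5.2.  Everything below is proved from Mathlib and the tree;
axioms are the standard three.
-/

set_option linter.dupNamespace false -- D-0017: single-problem summit ⇒ `QuantumAdvantage.QuantumAdvantage` by design

noncomputable section

namespace Summit.QuantumAdvantage.QuantumAdvantage.Theorems.CubicForrelation.NearExactIsExact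

open Finset
open Literature.Computability.QuantumComplexity
open Literature.Computability.QuantumComplexity.BuzetChailloux (bxor zeroVec bxor_bxor_cancel_left bxor_zeroVec zeroVec_bxor bxor_comm
  bxor_self)
open Literature.Computability.QuantumComplexity.DerivativeWalsh (W)

variable {n : ℕ}

/-! ### Flat points stay in a stable set -/

/-- **Flat points with directions in `V₀` stay in a `V₀`-stable set** (any number of directions). [folklore] -/
theorem ws_flatPt_mem (V₀ : Finset (Fin n → Bool)) (h0 : zeroVec ∈ V₀) (P : (Fin n → Bool) → Prop)
    (hPV : ∀ x, P x → ∀ a ∈ V₀, P (bxor x a)) :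
    ∀ (k : ℕ) (x : Fin n → Bool), P x → ∀ (a : Fin k → Fin n → Bool), (∀ i, a i ∈ V₀) → ∀ ε : Fin k → Bool,
      P (fun j => x j ^^ decide (Odd #(univ.filter fun i => ε i && a i j))) := by
  intro k
  induction k with
  | zero =>
    intro x hx a _ ε
    have e : (fun j => x j ^^ decide (Odd #(univ.filter fun i : Fin 0 => ε i && a i j))) = x := by
      funext j
      rw [show (univ.filter fun i : Fin 0 => ε i && a i j) = ∅ from filter_eq_empty_iff.2 fun i _ => i.elim0]
      simp
    rw [e]; exact hx
  | succ k ih =>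
    intro x hx a ha ε
    have ea : a = Fin.cons (a 0) (Fin.tail a) := (Fin.cons_self_tail a).symm
    have eε : ε = Fin.cons (ε 0) (Fin.tail ε) := (Fin.cons_self_tail ε).symm
    rw [ea, eε, erm_flatPt_cons]
    exact hPV _ (ih x hx (Fin.tail a) (fun i => ha i.succ) (Fin.tail ε)) _ (fr_smul_mem V₀ h0 (ha 0) (ε 0))

/-! ### One round of wild-point parity on a coset -/

/-- **One round of wild-point parity.**  Let `V₀ ∋ 0` be xor-closed with `#V₀ = 2^m`, `c` a base point and `ψ` an integer function whose
sum over every parametrised `(r+1)`-flat `b ⊕ ⟨a₀,…,a_r⟩` (`b ∈ c ⊕ V₀`, `aᵢ ∈ V₀`) is even.  Then either `ψ` is even at every point of the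
coset `c ⊕ V₀`, or it is odd at `≥ 2^{m−r}` points of it. [cite: MacWilliamsSloane1977, Ch. 13 §3 Thm 3] -/
theorem ws_erm_round (V₀ : Finset (Fin n → Bool)) (h0 : zeroVec ∈ V₀) (hadd : ∀ a ∈ V₀, ∀ b ∈ V₀, bxor a b ∈ V₀) {m : ℕ}
    (hcard : #V₀ = 2 ^ m) (c : Fin n → Bool) (ψ : (Fin n → Bool) → ℤ) (r : ℕ)
    (H : ∀ b ∈ V₀.image (bxor c), ∀ a : Fin (r + 1) → Fin n → Bool, (∀ i, a i ∈ V₀) →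
      (2 : ℤ) ∣ ∑ ε : Fin (r + 1) → Bool, ψ (fun j => b j ^^ decide (Odd #(univ.filter fun i => ε i && a i j)))) :
    (∀ x ∈ V₀.image (bxor c), Even (ψ x)) ∨ 2 ^ m ≤ 2 ^ r * #((V₀.image (bxor c)).filter fun x => Odd (ψ x)) := by
  classical
  by_cases hex : ∃ x ∈ V₀.image (bxor c), Odd (ψ x)
  · right
    have key := erm_weight_ge m r V₀ h0 (fun x hx y hy => hadd x hx y hy) hcard c (fun x => decide (Odd (ψ x)))
      (fun b hb a ha => by
        have hE := (tw_even_sum_iff univ _).1 (even_iff_two_dvd.2 (H b hb a ha))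
        have e : (univ.filter fun ε : Fin (r + 1) → Bool =>
            Odd (ψ (fun j => b j ^^ decide (Odd #(univ.filter fun i => ε i && a i j))))) =
            univ.filter fun ε : Fin (r + 1) → Bool =>
              decide (Odd (ψ (fun j => b j ^^ decide (Odd #(univ.filter fun i => ε i && a i j))))) = true :=
          filter_congr fun ε _ => by simp
        rwa [e] at hE)
      (by obtain ⟨x, hx, hodd⟩ := hex; exact ⟨x, hx, decide_eq_true hodd⟩)
    have e : ((V₀.image (bxor c)).filter fun x => decide (Odd (ψ x)) = true) =
        (V₀.image (bxor c)).filter fun x => Odd (ψ x) := filter_congr fun x _ => by simp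
    rwa [e] at key
  · left
    push Not at hex
    exact fun x hx => Int.not_odd_iff_even.1 (hex x hx)

/-! ### Translating by a period permutes a coset -/

/-- **Counting along a translate.**  For a coset `S = x₁ ⊕ V₀` of an xor-closed `V₀` and `v ∈ V₀`:
`#{x ∈ S : Q(x ⊕ v)} = #{x ∈ S : Q x}`. [folklore] -/
theorem ws_card_translate (V₀ S : Finset (Fin n → Bool)) (x₁ : Fin n → Bool) (hadd : ∀ a ∈ V₀, ∀ b ∈ V₀, bxor a b ∈ V₀)
    (hS : S = V₀.image (bxor x₁)) {v : Fin n → Bool} (hv : v ∈ V₀) (Q : (Fin n → Bool) → Prop) [DecidablePred Q] :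
    #(S.filter fun x => Q (bxor x v)) = #(S.filter Q) := by
  refine card_nbij' (fun x => bxor x v) (fun x => bxor x v) (fun x hx => ?_) (fun x hx => ?_)
    (fun x _ => by show bxor (bxor x v) v = x; rw [iw_bxor_assoc, bxor_self, bxor_zeroVec])
    (fun x _ => by show bxor (bxor x v) v = x; rw [iw_bxor_assoc, bxor_self, bxor_zeroVec])
  · rw [mem_coe, mem_filter] at hx ⊢
    exact ⟨fl1_coset_vadd hadd hS hx.1 hv, hx.2⟩
  · rw [mem_coe, mem_filter] at hx ⊢
    refine ⟨fl1_coset_vadd hadd hS hx.1 hv, ?_⟩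
    rw [iw_bxor_assoc, bxor_self, bxor_zeroVec]; exact hx.2

/-- A flat point is the base point translated by the flat point of the origin. [folklore] -/
theorem ws_flatPt_eq_bxor {k : ℕ} (x : Fin n → Bool) (a : Fin k → Fin n → Bool) (ε : Fin k → Bool) :
    (fun j => x j ^^ decide (Odd #(univ.filter fun i => ε i && a i j))) =
      bxor x (fun j => zeroVec j ^^ decide (Odd #(univ.filter fun i => ε i && a i j))) := by
  funext j; simp [bxor, zeroVec]

/-! ### The 4-flat sign sum of a quadratic-along-the-coset function, mod 8 -/



/-- **The 4-flat sign sum of a function with base-free second differences, mod 8.**  Let `S = {P}` be stable under `⊕ V₀` and let `h`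
satisfy `h(x ⊕ p ⊕ q) = h(x) ⊕ h(x⊕p) ⊕ h(x⊕q) ⊕ B(p,q)` on `S` (`p, q ∈ V₀`), with `B(p,q) = h(x₀) ⊕ h(x₀⊕p) ⊕ h(x₀⊕q) ⊕ h(x₀⊕p⊕q)`
(the conclusion of `fr_hsd`).  Then for `x ∈ S` and `a₀, a₁, a₂, a₃ ∈ V₀` the sign sum over the parametrised 4-flat `x ⊕ ⟨a₀,a₁,a₂,a₃⟩` is
`≡ 4·Pf (mod 8)`, `Pf = B(a₁,a₀)B(a₃,a₂) ⊕ B(a₂,a₀)B(a₃,a₁) ⊕ B(a₃,a₀)B(a₂,a₁)` — independently of the base point `x`. [this work] -/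
theorem ws_sum4_mod8 (V₀ : Finset (Fin n → Bool)) (P : (Fin n → Bool) → Prop) (x₀ : Fin n → Bool) (h : (Fin n → Bool) → Bool)
    (hPV : ∀ x, P x → ∀ a ∈ V₀, P (bxor x a))
    (hsd : ∀ x, P x → ∀ p ∈ V₀, ∀ q ∈ V₀, h (bxor (bxor x p) q) =
      (h x ^^ h (bxor x p) ^^ h (bxor x q) ^^ (h x₀ ^^ h (bxor x₀ p) ^^ h (bxor x₀ q) ^^ h (bxor (bxor x₀ p) q))))
    {x a₀ a₁ a₂ a₃ : Fin n → Bool} (hx : P x) (ha₀ : a₀ ∈ V₀) (ha₁ : a₁ ∈ V₀) (ha₂ : a₂ ∈ V₀) (ha₃ : a₃ ∈ V₀) :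
    (∑ ε : Fin 4 → Bool, sZ (h (fun j => x j ^^ decide (Odd #(univ.filter fun i =>
        ε i && (![a₀, a₁, a₂, a₃] : Fin 4 → Fin n → Bool) i j))))) % 8 =
      if (((h x₀ ^^ h (bxor x₀ a₁) ^^ h (bxor x₀ a₀) ^^ h (bxor (bxor x₀ a₁) a₀)) &&
            (h x₀ ^^ h (bxor x₀ a₃) ^^ h (bxor x₀ a₂) ^^ h (bxor (bxor x₀ a₃) a₂))) ^^
          ((h x₀ ^^ h (bxor x₀ a₂) ^^ h (bxor x₀ a₀) ^^ h (bxor (bxor x₀ a₂) a₀)) &&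
            (h x₀ ^^ h (bxor x₀ a₃) ^^ h (bxor x₀ a₁) ^^ h (bxor (bxor x₀ a₃) a₁))) ^^
          ((h x₀ ^^ h (bxor x₀ a₃) ^^ h (bxor x₀ a₀) ^^ h (bxor (bxor x₀ a₃) a₀)) &&
            (h x₀ ^^ h (bxor x₀ a₂) ^^ h (bxor x₀ a₁) ^^ h (bxor (bxor x₀ a₂) a₁)))) = true then 4 else 0 := by
  have e4 := fr_sum4 (fun y => sZ (h y)) x a₀ a₁ a₂ a₃
  beta_reduce at e4
  rw [e4]
  clear e4
  -- the six Gram entries as opaque Booleans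
  obtain ⟨B10, hB10⟩ : ∃ b, (h x₀ ^^ h (bxor x₀ a₁) ^^ h (bxor x₀ a₀) ^^ h (bxor (bxor x₀ a₁) a₀)) = b := ⟨_, rfl⟩
  obtain ⟨B20, hB20⟩ : ∃ b, (h x₀ ^^ h (bxor x₀ a₂) ^^ h (bxor x₀ a₀) ^^ h (bxor (bxor x₀ a₂) a₀)) = b := ⟨_, rfl⟩
  obtain ⟨B21, hB21⟩ : ∃ b, (h x₀ ^^ h (bxor x₀ a₂) ^^ h (bxor x₀ a₁) ^^ h (bxor (bxor x₀ a₂) a₁)) = b := ⟨_, rfl⟩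
  obtain ⟨B30, hB30⟩ : ∃ b, (h x₀ ^^ h (bxor x₀ a₃) ^^ h (bxor x₀ a₀) ^^ h (bxor (bxor x₀ a₃) a₀)) = b := ⟨_, rfl⟩
  obtain ⟨B31, hB31⟩ : ∃ b, (h x₀ ^^ h (bxor x₀ a₃) ^^ h (bxor x₀ a₁) ^^ h (bxor (bxor x₀ a₃) a₁)) = b := ⟨_, rfl⟩
  obtain ⟨B32, hB32⟩ : ∃ b, (h x₀ ^^ h (bxor x₀ a₃) ^^ h (bxor x₀ a₂) ^^ h (bxor (bxor x₀ a₃) a₂)) = b := ⟨_, rfl⟩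
  rw [hB10, hB20, hB21, hB30, hB31, hB32]
  -- membership of the intermediate base points
  have hx2 : P (bxor x a₂) := hPV _ hx _ ha₂
  have hx3 : P (bxor x a₃) := hPV _ hx _ ha₃
  have hx32 : P (bxor (bxor x a₃) a₂) := hPV _ hx3 _ ha₂
  -- depth two
  have e10 : h (bxor (bxor x a₁) a₀) = (h x ^^ h (bxor x a₁) ^^ h (bxor x a₀) ^^ B10) := by rw [← hB10]; exact hsd x hx a₁ ha₁ a₀ ha₀
  have e20 : h (bxor (bxor x a₂) a₀) = (h x ^^ h (bxor x a₂) ^^ h (bxor x a₀) ^^ B20) := by rw [← hB20]; exact hsd x hx a₂ ha₂ a₀ ha₀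
  have e21 : h (bxor (bxor x a₂) a₁) = (h x ^^ h (bxor x a₂) ^^ h (bxor x a₁) ^^ B21) := by rw [← hB21]; exact hsd x hx a₂ ha₂ a₁ ha₁
  have e30 : h (bxor (bxor x a₃) a₀) = (h x ^^ h (bxor x a₃) ^^ h (bxor x a₀) ^^ B30) := by rw [← hB30]; exact hsd x hx a₃ ha₃ a₀ ha₀
  have e31 : h (bxor (bxor x a₃) a₁) = (h x ^^ h (bxor x a₃) ^^ h (bxor x a₁) ^^ B31) := by rw [← hB31]; exact hsd x hx a₃ ha₃ a₁ ha₁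
  have e32 : h (bxor (bxor x a₃) a₂) = (h x ^^ h (bxor x a₃) ^^ h (bxor x a₂) ^^ B32) := by rw [← hB32]; exact hsd x hx a₃ ha₃ a₂ ha₂
  -- depth three
  have e210 : h (bxor (bxor (bxor x a₂) a₁) a₀) = (h (bxor x a₂) ^^ h (bxor (bxor x a₂) a₁) ^^ h (bxor (bxor x a₂) a₀) ^^ B10) := by
    rw [← hB10]; exact hsd _ hx2 a₁ ha₁ a₀ ha₀
  have e310 : h (bxor (bxor (bxor x a₃) a₁) a₀) = (h (bxor x a₃) ^^ h (bxor (bxor x a₃) a₁) ^^ h (bxor (bxor x a₃) a₀) ^^ B10) := by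
    rw [← hB10]; exact hsd _ hx3 a₁ ha₁ a₀ ha₀
  have e320 : h (bxor (bxor (bxor x a₃) a₂) a₀) = (h (bxor x a₃) ^^ h (bxor (bxor x a₃) a₂) ^^ h (bxor (bxor x a₃) a₀) ^^ B20) := by
    rw [← hB20]; exact hsd _ hx3 a₂ ha₂ a₀ ha₀
  have e321 : h (bxor (bxor (bxor x a₃) a₂) a₁) = (h (bxor x a₃) ^^ h (bxor (bxor x a₃) a₂) ^^ h (bxor (bxor x a₃) a₁) ^^ B21) := by
    rw [← hB21]; exact hsd _ hx3 a₂ ha₂ a₁ ha₁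
  -- depth four
  have e3210 : h (bxor (bxor (bxor (bxor x a₃) a₂) a₁) a₀) =
      (h (bxor (bxor x a₃) a₂) ^^ h (bxor (bxor (bxor x a₃) a₂) a₁) ^^ h (bxor (bxor (bxor x a₃) a₂) a₀) ^^ B10) := by
    rw [← hB10]; exact hsd _ hx32 a₁ ha₁ a₀ ha₀
  rw [e3210, e321, e320, e310, e210, e32, e31, e30, e21, e20, e10]
  clear e3210 e321 e320 e310 e210 e32 e31 e30 e21 e20 e10 hB10 hB20 hB21 hB30 hB31 hB32 hx2 hx3 hx32 hsd hPV hx ha₀ ha₁ ha₂ ha₃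
  generalize h x = A
  generalize h (bxor x a₀) = A0
  generalize h (bxor x a₁) = A1
  generalize h (bxor x a₂) = A2
  generalize h (bxor x a₃) = A3
  revert A A0 A1 A2 A3 B10 B20 B21 B30 B31 B32
  decide

end Summit.QuantumAdvantage.QuantumAdvantage.Theorems.CubicForrelation.NearExactIsExact

end
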